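import Summits.Langlands.Langlands.Theses.SplitPrimeInduction
import Literature.Algebra.Homology.GroupCohomologyCentralElement

/-!
# `MonomialSerreAtSplitPrimes` (stmt-Langlands-16951), negative side I: central Hecke operators and neighbourhoods of `1`

Negative-side lemmas (refuter, crux attack at birth, 2026-08-17; supports stmt-Langlands-16951), part 1
of the chain `CentralHeckeNeighbourhoods → RatPlacesTestIdele → FalseOfCubicField` proving that the
crux fails for every complex cubic field with a completely split odd prime and the `(1,2)` splitting law
on the primes `ℓ ≡ -1 (mod M₀)` — e.g. `ℚ(∛2)`, `p = 31`, `M₀ = 3` (the crux is false on its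
even-real sector; see the last file for the mechanism).

* §1 (after the planner's `Cruxes/MonomialSerreAtSplitPrimes/Lines/birth.lean` §6): in the tree's model
  `H^i(X_L, M) = H^i(Γ, Fun(𝒢 ⧸ L, M))` (`ArithmeticQuotient.cohomology`) the Hecke operator
  `[L (ι γ) L]` of a central `γ ∈ Z(Γ)` with `ι γ ∈ Z(𝒢)` is the identity (central elements act
  trivially on group cohomology, `Literature.Algebra.Homology.map_apply_eq_self_of_central`); for
  `GL_n` over a number field: the Hecke operator of a principal scalar finite idèle `r·1` is the identity.
* §2: `[L g L]` depends only on the coset `gL`; the top Hecke element `diag(ϖ_v, …, ϖ_v)` is the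
  central scalar (Mathlib `Matrix.GeneralLinearGroup.scalar`) of the local idèle of `ϖ_v`.
* §3: the finite adèle ring carries the restricted product topology, in which `∏_v 𝒪_v` is an open
  subspace with the product topology (Mathlib `RestrictedProduct.nhds_eq_map_structureMap`); hence a
  neighbourhood of `1` in `𝔸_K^∞` contains every integral adèle `v`-adically close to `1` at finitely
  many places, the same holds in the unit group (unit topology `Mˣ ↪ M × Mᵐᵒᵖ`), and — through the
  continuous scalar embedding — every OPEN subset of `GL_n(𝔸_K^∞)` containing `1` contains all scalars
  `y·1` with `y, y⁻¹` integral everywhere and `≡ 1` to prescribed depths at finitely many places.  This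
  is the only use of the hypothesis `IsOpen K'` of the crux.

References: J.-P. Serre, *Local Fields*, VII §5 Prop. 3 [SerreLocalFields1979]; P. Scholze, Ann. of
Math. 182 (2015) §V.4 [Scholze2015]; Mathlib only otherwise.
-/

noncomputable section

set_option linter.dupNamespace false -- `Summit.Langlands.Langlands` is the mandated namespace (D-0017)

open scoped NumberField Classical Polynomial Topology RestrictedProduct
open IsDedekindDomain NumberField Polynomial Filter
open Literature.NumberTheory.Automorphic Literature.NumberTheory.GaloisRepresentations

namespace Summit.Langlands.Langlands.Theorems.MonomialSerreAtSplitPrimes.Negative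

/-! ## 1. Hecke operators of central elements (after the planner's `Lines/birth.lean` §6) -/

section Central

universe u

variable (k : Type u) [CommRing k] {Γ 𝒢 : Type u} [Group Γ] [Group 𝒢]
  (ι : Γ →* 𝒢) (L : Subgroup 𝒢) (M : Type u) [AddCommGroup M] [Module k M]

omit [Group Γ] in
variable {k ι M} in
/-- For `g` central in `𝒢`, the double coset `L g L / L` is the single coset `gL`. [folklore] -/
theorem doubleCosetQuot_of_mem_center {g : 𝒢} (hg : g ∈ Subgroup.center 𝒢) :
    ArithmeticQuotient.doubleCosetQuot L g = {(g : 𝒢 ⧸ L)} := by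
  ext d
  simp only [Set.mem_singleton_iff, ArithmeticQuotient.doubleCosetQuot]
  constructor
  · rintro ⟨m, rfl⟩
    show ((m : 𝒢) • (g : 𝒢 ⧸ L)) = _
    rw [MulAction.Quotient.smul_coe, smul_eq_mul, Subgroup.mem_center_iff.1 hg (m : 𝒢)]
    exact QuotientGroup.eq.mpr (by simp)
  · rintro rfl
    exact MulAction.mem_orbit_self _

omit [Group Γ] in
variable {ι} in
/-- For `g` central in `𝒢`, `T_g = [L g L]` on `Fun(𝒢 ⧸ L, M)` is the translation
`(T_g f)(c) = f(g • c)`. [folklore] -/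
theorem heckeFun_apply_of_mem_center {g : 𝒢} (hg : g ∈ Subgroup.center 𝒢) (f : (𝒢 ⧸ L) → M)
    (c : 𝒢 ⧸ L) : ArithmeticQuotient.heckeFun k L g M f c = f (g • c) := by
  classical
  have hfin : (ArithmeticQuotient.doubleCosetQuot L g).Finite := by
    rw [doubleCosetQuot_of_mem_center L hg]
    exact Set.finite_singleton _
  have hset : hfin.toFinset = {(g : 𝒢 ⧸ L)} :=
    Finset.ext fun d => by rw [Set.Finite.mem_toFinset, doubleCosetQuot_of_mem_center L hg]; simp
  rw [ArithmeticQuotient.heckeFun_apply, dif_pos hfin, hset, Finset.sum_singleton,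
    MulAction.Quotient.smul_coe, smul_eq_mul, Subgroup.mem_center_iff.1 hg c.out]
  congr 1
  conv_rhs => rw [← QuotientGroup.out_eq' c]
  rfl

/-- **Central elements of `Γ` act trivially through their Hecke operators.**  If `γ ∈ Z(Γ)` and
`ι γ ∈ Z(𝒢)`, then `T_{ι γ} = [L (ι γ) L]` is the identity of `H^i(X_L, M) = H^i(Γ, Fun(𝒢 ⧸ L, M))`:
on coefficients `T_{ιγ} f = f(ιγ • ·) = ρ(γ⁻¹) f`, and `γ⁻¹ ∈ Z(Γ)` acts trivially on group
cohomology. [cite: SerreLocalFields1979, Ch. VII §5, Prop. 3] -/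
theorem heckeEnd_apply_of_mem_center {γ : Γ} (hγ : γ ∈ Subgroup.center Γ)
    (hιγ : ι γ ∈ Subgroup.center 𝒢) (i : ℕ) (x : ArithmeticQuotient.cohomology k ι L M i) :
    ArithmeticQuotient.heckeEnd k L (ι γ) M ι i x = x := by
  refine Literature.Algebra.Homology.map_apply_eq_self_of_central (ArithmeticQuotient.coeffRep k ι L M)
    (Subgroup.inv_mem _ hγ) (ArithmeticQuotient.heckeRepHom k L (ι γ) M ι) (fun f => ?_) i x
  change ArithmeticQuotient.heckeFun k L (ι γ) M f = ArithmeticQuotient.coeffRepresentation k ι L M γ⁻¹ f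
  ext c
  rw [heckeFun_apply_of_mem_center k L M hιγ, ArithmeticQuotient.coeffRepresentation_apply, map_inv,
    inv_inv]

/-- Scalar matrices are central in `GL_n(R)` (Mathlib `Matrix.GeneralLinearGroup.center_eq_range_scalar`).
[folklore] -/
theorem scalar_mem_center (n : ℕ) (R : Type u) [CommRing R] (r : Rˣ) :
    Matrix.GeneralLinearGroup.scalar (Fin n) r ∈ Subgroup.center (GL (Fin n) R) := by
  rw [Matrix.GeneralLinearGroup.center_eq_range_scalar]
  exact ⟨r, rfl⟩

/-- **Central sign lemma for `GL_n` over a number field**: the Hecke operator of a principal scalar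
finite idèle `r·1`, `r ∈ F^×`, is the identity on `H^i(X_K, M)`.
[cite: SerreLocalFields1979, Ch. VII §5, Prop. 3] -/
theorem heckeEnd_principalScalar_apply (n : ℕ) (F : Type) [Field F] [NumberField F] (k : Type)
    [CommRing k] (K : Subgroup (GL (Fin n) (FiniteAdeleRing (𝓞 F) F))) (M : Type) [AddCommGroup M]
    [Module k M] (r : Fˣ) (i : ℕ) (x : ArithmeticQuotient.cohomology k
      (Matrix.GeneralLinearGroup.map (algebraMap F (FiniteAdeleRing (𝓞 F) F))) K M i) :
    ArithmeticQuotient.heckeEnd k K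
      (Matrix.GeneralLinearGroup.map (algebraMap F (FiniteAdeleRing (𝓞 F) F))
        (Matrix.GeneralLinearGroup.scalar (Fin n) r)) M
      (Matrix.GeneralLinearGroup.map (algebraMap F (FiniteAdeleRing (𝓞 F) F))) i x = x :=
  heckeEnd_apply_of_mem_center k _ K M (scalar_mem_center n F r)
    (by rw [Matrix.GeneralLinearGroup.map_scalar]; exact scalar_mem_center _ _ _) i x

/-! ## 2. Hecke operators only see the coset `gL`; the top Hecke element is a central scalar -/

omit [Group Γ] in
variable {k M} in
/-- `[L g L]` depends only on the coset `g L`: if `g L = g' L` then `T_g = T_{g'}`. [folklore] -/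
theorem heckeFun_eq_of_coe_eq {g g' : 𝒢} (h : (g : 𝒢 ⧸ L) = g') :
    ArithmeticQuotient.heckeFun k L g M = ArithmeticQuotient.heckeFun k L g' M := by
  have hq : ArithmeticQuotient.doubleCosetQuot L g = ArithmeticQuotient.doubleCosetQuot L g' := by
    simp only [ArithmeticQuotient.doubleCosetQuot, h]
  refine LinearMap.ext fun f => funext fun c => ?_
  rw [ArithmeticQuotient.heckeFun_apply, ArithmeticQuotient.heckeFun_apply, hq]

variable {k M} in
/-- Hence the Hecke operators on `H^i(X_L, M)` of `g` and `g'` agree when `g L = g' L`. [folklore] -/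
theorem heckeEnd_eq_of_coe_eq {g g' : 𝒢} (h : (g : 𝒢 ⧸ L) = g') (i : ℕ) :
    ArithmeticQuotient.heckeEnd k L g M ι i = ArithmeticQuotient.heckeEnd k L g' M ι i := by
  have : ArithmeticQuotient.heckeRepHom k L g M ι = ArithmeticQuotient.heckeRepHom k L g' M ι :=
    Rep.hom_ext (Representation.IntertwiningMap.ext (heckeFun_eq_of_coe_eq L h))
  simp only [ArithmeticQuotient.heckeEnd, ArithmeticQuotient.heckeOperator, this]

end Central

/-- The top Hecke element `t_{v,n} = diag(ϖ_v, …, ϖ_v)` (all `n` slots) projects to the central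
scalar `ϖ_v · 1 ∈ GL_n(𝔸_K^∞)` of the local idèle of `ϖ_v`. [folklore] -/
theorem sndHom_heckeDiagAt_self (n : ℕ) (K : Type) [Field K] [NumberField K]
    (v : HeightOneSpectrum (𝓞 K)) (ϖ : (v.adicCompletion K)ˣ) :
    GLn.sndHom n K (heckeDiagAt n K v ϖ n) =
      Matrix.GeneralLinearGroup.scalar (Fin n) (uniformizerIdele K v ϖ) := by
  refine Matrix.GeneralLinearGroup.ext fun i j => ?_
  change ((heckeDiagAt n K v ϖ n : GL (Fin n) (AdeleRing (𝓞 K) K)) i j).2 =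
    Matrix.scalar (Fin n) ((uniformizerIdele K v ϖ : (FiniteAdeleRing (𝓞 K) K)ˣ) :
      FiniteAdeleRing (𝓞 K) K) i j
  rw [heckeDiagAt, coe_glDiagonal, Matrix.scalar_apply, Matrix.diagonal_apply, Matrix.diagonal_apply]
  by_cases h : i = j
  · subst h
    simp [i.isLt]
  · simp only [h, if_false]
    rfl

/-! ## 3. Neighbourhoods of `1` in `𝔸_K^∞`, in its unit group, and in `GL_n(𝔸_K^∞)` -/

section Nbhd

variable (K : Type) [Field K] [NumberField K]

/-- In a valued ring, a neighbourhood of `0` contains an open ball `{v < γ}`, `γ ≠ 0`, of the value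
group. [folklore] -/
theorem exists_ball_subset_of_mem_nhds_zero {R : Type} [CommRing R] {Γ₀ : Type}
    [LinearOrderedCommGroupWithZero Γ₀] [hv : Valued R Γ₀] {s : Set R} (hs : s ∈ 𝓝 (0 : R)) :
    ∃ γ : Γ₀, γ ≠ 0 ∧ ∀ x : R, Valued.v x < γ → x ∈ s := by
  obtain ⟨γ, hγ⟩ := (Valued.mem_nhds_zero (R := R)).1 hs
  refine ⟨MonoidWithZeroHom.ValueGroup₀.embedding γ.1, ?_, fun x hx => hγ ?_⟩
  · intro h0
    apply γ.ne_zero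
    apply MonoidWithZeroHom.ValueGroup₀.embedding_strictMono.injective
    rw [h0, map_zero]
  · exact (Valuation.restrict_lt_iff_lt_embedding _).2 hx

/-- **Neighbourhoods of `1` in the finite adèle ring.**  A neighbourhood `W` of `1` in `𝔸_K^∞`
contains every integral finite adèle that is `v`-adically close to `1` at finitely many places `v`
(restricted product topology: `∏_v 𝒪_v` is an open subspace carrying the product topology).
[folklore] -/
theorem exists_forall_mem_of_mem_nhds_one {W : Set (FiniteAdeleRing (𝓞 K) K)}
    (hW : W ∈ 𝓝 (1 : FiniteAdeleRing (𝓞 K) K)) :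
    ∃ (I : Set (HeightOneSpectrum (𝓞 K))) (_ : I.Finite) (γ : HeightOneSpectrum (𝓞 K) → WithZero (Multiplicative ℤ)),
      (∀ v, γ v ≠ 0) ∧ ∀ a : FiniteAdeleRing (𝓞 K) K, (∀ v, a v ∈ v.adicCompletionIntegers K) →
        (∀ v ∈ I, Valued.v (a v - 1) < γ v) → a ∈ W := by
  -- the structure map `∏_v 𝒪_v → 𝔸_K^∞` and the point `1`
  let A : (v : HeightOneSpectrum (𝓞 K)) → Set (v.adicCompletion K) :=
    fun v => (v.adicCompletionIntegers K : Set (v.adicCompletion K))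
  have hAopen : ∀ v, IsOpen (A v) := fun v => Valued.isOpen_valuationSubring _
  let one' : (v : HeightOneSpectrum (𝓞 K)) → A v := fun v => ⟨1, one_mem _⟩
  have h1 : RestrictedProduct.structureMap (fun v : HeightOneSpectrum (𝓞 K) => v.adicCompletion K)
      A cofinite one' = (1 : FiniteAdeleRing (𝓞 K) K) :=
    Subtype.ext (funext fun v => rfl)
  have hW' : W ∈ 𝓝 (RestrictedProduct.structureMap
      (fun v : HeightOneSpectrum (𝓞 K) => v.adicCompletion K) A cofinite one') := by
    rw [h1]; exact hW
  rw [RestrictedProduct.nhds_eq_map_structureMap hAopen one'] at hW'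
  have hW'' : (RestrictedProduct.structureMap
      (fun v : HeightOneSpectrum (𝓞 K) => v.adicCompletion K) A cofinite) ⁻¹' W ∈ 𝓝 one' := hW'
  rw [nhds_pi, Filter.mem_pi] at hW''
  obtain ⟨I, hI, t, ht, hts⟩ := hW''
  -- at each place, `t v` contains a valuation ball around `1`
  have key : ∀ v, ∃ γ : WithZero (Multiplicative ℤ), γ ≠ 0 ∧ ∀ y : v.adicCompletion K, ∀ hy : y ∈ A v,
      Valued.v (y - 1) < γ → (⟨y, hy⟩ : A v) ∈ t v := by
    intro v
    have htv := ht v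
    rw [nhds_induced, Filter.mem_comap] at htv
    obtain ⟨u, hu, hut⟩ := htv
    have hu0 : (fun y => y + 1) ⁻¹' u ∈ 𝓝 (0 : v.adicCompletion K) := by
      refine (continuous_add_const (1 : v.adicCompletion K)).continuousAt.preimage_mem_nhds ?_
      simpa using hu
    obtain ⟨γ, hγ0, hγ⟩ := exists_ball_subset_of_mem_nhds_zero hu0
    refine ⟨γ, hγ0, fun y hy hlt => hut ?_⟩
    have := hγ (y - 1) hlt
    simpa using this
  choose γ hγ0 hγ using key
  refine ⟨I, hI, γ, hγ0, fun a ha hclose => ?_⟩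
  let x : (v : HeightOneSpectrum (𝓞 K)) → A v := fun v => ⟨a v, ha v⟩
  have hx : RestrictedProduct.structureMap (fun v : HeightOneSpectrum (𝓞 K) => v.adicCompletion K)
      A cofinite x = a := Subtype.ext (funext fun v => rfl)
  have hmem : x ∈ I.pi t := fun v hv => hγ v (a v) (ha v) (hclose v hv)
  have := hts hmem
  rwa [Set.mem_preimage, hx] at this

/-- **Neighbourhoods of `1` in the finite idèle group** (unit topology): a neighbourhood of `1` in
`(𝔸_K^∞)ˣ` contains every unit `y` with `y, y⁻¹` integral everywhere and `v`-adically close to `1`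
at finitely many places. [folklore] -/
theorem exists_forall_mem_of_mem_nhds_one_units {W : Set (FiniteAdeleRing (𝓞 K) K)ˣ}
    (hW : W ∈ 𝓝 (1 : (FiniteAdeleRing (𝓞 K) K)ˣ)) :
    ∃ (I : Set (HeightOneSpectrum (𝓞 K))) (_ : I.Finite) (γ : HeightOneSpectrum (𝓞 K) → WithZero (Multiplicative ℤ)),
      (∀ v, γ v ≠ 0) ∧ ∀ y : (FiniteAdeleRing (𝓞 K) K)ˣ,
        (∀ v, (y : FiniteAdeleRing (𝓞 K) K) v ∈ v.adicCompletionIntegers K ∧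
          ((y⁻¹ : (FiniteAdeleRing (𝓞 K) K)ˣ) : FiniteAdeleRing (𝓞 K) K) v ∈
            v.adicCompletionIntegers K) →
        (∀ v ∈ I, Valued.v ((y : FiniteAdeleRing (𝓞 K) K) v - 1) < γ v ∧
          Valued.v (((y⁻¹ : (FiniteAdeleRing (𝓞 K) K)ˣ) : FiniteAdeleRing (𝓞 K) K) v - 1) < γ v) →
        y ∈ W := by
  rw [nhds_induced, Filter.mem_comap] at hW
  obtain ⟨V, hV, hVW⟩ := hW
  rw [Units.embedProduct_apply, inv_one, Units.val_one, MulOpposite.op_one,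
    mem_nhds_prod_iff] at hV
  obtain ⟨V₁, hV₁, V₂, hV₂, hV12⟩ := hV
  rw [← MulOpposite.op_one, ← MulOpposite.map_op_nhds, Filter.mem_map] at hV₂
  obtain ⟨I₁, hI₁, γ₁, hγ₁0, h₁⟩ := exists_forall_mem_of_mem_nhds_one K hV₁
  obtain ⟨I₂, hI₂, γ₂, hγ₂0, h₂⟩ := exists_forall_mem_of_mem_nhds_one K hV₂
  refine ⟨I₁ ∪ I₂, hI₁.union hI₂, fun v => min (γ₁ v) (γ₂ v), fun v => ?_, fun y hint hclose => ?_⟩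
  · show min (γ₁ v) (γ₂ v) ≠ 0
    rcases min_choice (γ₁ v) (γ₂ v) with h | h <;> rw [h]
    · exact hγ₁0 v
    · exact hγ₂0 v
  · apply hVW
    rw [Set.mem_preimage, Units.embedProduct_apply]
    refine hV12 (Set.mk_mem_prod ?_ ?_)
    · exact h₁ _ (fun v => (hint v).1) fun v hv =>
        (hclose v (Or.inl hv)).1.trans_le (min_le_left _ _)
    · exact h₂ _ (fun v => (hint v).2) fun v hv =>
        (hclose v (Or.inr hv)).2.trans_le (min_le_right _ _)

/-- The scalar embedding `(𝔸_K^∞)ˣ → GL_n(𝔸_K^∞)` is continuous. [folklore] -/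
theorem continuous_scalar (n : ℕ) :
    Continuous (Matrix.GeneralLinearGroup.scalar (Fin n) :
      (FiniteAdeleRing (𝓞 K) K)ˣ → GL (Fin n) (FiniteAdeleRing (𝓞 K) K)) := by
  refine Units.continuous_map ?_
  change Continuous fun a : FiniteAdeleRing (𝓞 K) K => Matrix.scalar (Fin n) a
  simp_rw [Matrix.scalar_apply]
  exact (continuous_pi fun _ => continuous_id).matrix_diagonal

/-- **Open subsets of `GL_n(𝔸_K^∞)` containing `1` contain all scalar units close to `1`:** if `U`
is open with `1 ∈ U`, there are finitely many places `I` and bounds `γ_v ≠ 0` such that every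
finite idèle `y` with `y, y⁻¹` integral everywhere and `v(y_v - 1), v(y_v⁻¹ - 1) < γ_v` for
`v ∈ I` has `y · 1 ∈ U`. [folklore] -/
theorem exists_forall_scalar_mem {n : ℕ} {U : Set (GL (Fin n) (FiniteAdeleRing (𝓞 K) K))}
    (hU : IsOpen U) (h1 : (1 : GL (Fin n) (FiniteAdeleRing (𝓞 K) K)) ∈ U) :
    ∃ (I : Set (HeightOneSpectrum (𝓞 K))) (_ : I.Finite) (γ : HeightOneSpectrum (𝓞 K) → WithZero (Multiplicative ℤ)),
      (∀ v, γ v ≠ 0) ∧ ∀ y : (FiniteAdeleRing (𝓞 K) K)ˣ,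
        (∀ v, (y : FiniteAdeleRing (𝓞 K) K) v ∈ v.adicCompletionIntegers K ∧
          ((y⁻¹ : (FiniteAdeleRing (𝓞 K) K)ˣ) : FiniteAdeleRing (𝓞 K) K) v ∈
            v.adicCompletionIntegers K) →
        (∀ v ∈ I, Valued.v ((y : FiniteAdeleRing (𝓞 K) K) v - 1) < γ v ∧
          Valued.v (((y⁻¹ : (FiniteAdeleRing (𝓞 K) K)ˣ) : FiniteAdeleRing (𝓞 K) K) v - 1) < γ v) →
        Matrix.GeneralLinearGroup.scalar (Fin n) y ∈ U := by
  have hW : (Matrix.GeneralLinearGroup.scalar (Fin n) :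
      (FiniteAdeleRing (𝓞 K) K)ˣ → GL (Fin n) (FiniteAdeleRing (𝓞 K) K)) ⁻¹' U ∈
        𝓝 (1 : (FiniteAdeleRing (𝓞 K) K)ˣ) :=
    (hU.preimage (continuous_scalar K n)).mem_nhds (by simpa using h1)
  obtain ⟨I, hI, γ, hγ0, h⟩ := exists_forall_mem_of_mem_nhds_one_units K hW
  exact ⟨I, hI, γ, hγ0, fun y hint hclose => h y hint hclose⟩

end Nbhd


end Summit.Langlands.Langlands.Theorems.MonomialSerreAtSplitPrimes.Negative

end
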